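import Mathlib
import Summits.NavierStokesRegularity.NavierStokesRegularity.Theorems.WakeRatchetTailRatchetPostFiringClock
import HarnessLib

/-!
# `WakeRatchet.TailRatchet` (stmt-NavierStokesRegularity-21808), door D4′ — PRE-FIRING ACTION and WINDOW MASS
# of a quiet-start half-line solution of the renormalised dyadic lattice under post-firing decay (D′)

Def-free support lemmas continuing `WakeRatchetTailRatchetPostFiringClock` (same setting, hypotheses explicit in
every lemma; MODEL lattice ODEs of Tao 2016 §1.2 / §4 / §6.4; nothing here concerns the Navier–Stokes equations;
stmt-21808 is neither proved nor refuted here and no stub of skeleton d00b85951d7c is closed).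

CONTENT: with `s` the first firing log-times,
* `postFiring_integrals_le`: (D′) ⟹ `∫_{s n}^{b} W_n ≤ D`, `∫_{s n}^{b} W_n² ≤ D²/2`;
* `preFiring_action_succ_le`: the recursion `a_{n+1} ≤ (Λc)·a_n + ΛD²/2` for the pre-firing actions
  `a_n = ∫_A^{s n} W_n` (tree `WakeRatchetFiringClock.preFiring_action_le`: the shell born empty has `v + ∫v ≤ Λ∫u²`,
  and the feed's square-action splits at its own first firing);
* `preFiring_action_le_uniform`: `a_n ≤ (ΛD²/2)/(1 − Λc)` for all `n` (`Λc < 1`, `s 0 = A`; tree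
  `action_recursion_bound`);
* `windowMass_le`: the uniform per-shell WINDOW-MASS bound `∫_a^b |W_m| ≤ (ΛD²/2)/(1−Λc) + D` (`A < a ≤ b`) —
  the clause (W) of `DyadicPersistentFrames` is a consequence of (D′).

HONEST FRAMING: elementary real analysis on a MODEL lattice; the estimate (D′) is a HYPOTHESIS here; rung 0.
-/

noncomputable section

set_option linter.dupNamespace false

namespace Summit.NavierStokesRegularity.NavierStokesRegularity.Theorems

namespace WakeRatchetDyadicPostFiring

open Set Filter Topology MeasureTheory intervalIntegral
open WakeRatchetFiringClock

variable {Λ : ℝ} {W : ℤ → ℝ → ℝ} {A₀ A B c D : ℝ}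

/-! ## Pre-firing action: the recursion `a (n+1) ≤ (Λc)·a n + ΛD²/2` and the uniform bound -/

/-- **Post-firing tail integrals.**  After its first firing a shell has `∫_{s n}^{b} W n ≤ D` and
`∫_{s n}^{b} (W n)² ≤ D²/2`.
[cite: Tao2016AveragedNS, §6.4; elementary (integrate `D e^{−(u−s)}`, `D² e^{−2(u−s)}`)] -/
theorem postFiring_integrals_le (hA : A₀ < A)
    (hlaw : ∀ (n : ℤ) (σ : ℝ), A₀ < σ → HasDerivAt (W n)
      (-(W n σ) + Λ * W (n - 1) σ ^ 2 - Λ⁻¹ * W n σ * W (n + 1) σ) σ)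
    (hnn : ∀ (n : ℤ) (σ : ℝ), A ≤ σ → 0 ≤ W n σ)
    (hdec : ∀ (n : ℤ) (σ₁ σ₂ : ℝ), A ≤ σ₁ → σ₁ ≤ σ₂ → c ≤ W n σ₁ →
      W n σ₂ ≤ D * Real.exp (-(σ₂ - σ₁)))
    {s : ℕ → ℝ} (hs1 : ∀ n : ℕ, A ≤ s n) (hs2 : ∀ n : ℕ, c ≤ W n (s n))
    (n : ℕ) {b : ℝ} (hb : s n ≤ b) :
    (∫ u in s n..b, W (n : ℤ) u) ≤ D ∧ (∫ u in s n..b, W (n : ℤ) u ^ 2) ≤ D ^ 2 / 2 := by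
  have hsA : A₀ < s n := hA.trans_le (hs1 n)
  have hbA : A₀ < b := hsA.trans_le hb
  have hD : 0 ≤ D := by
    have h1 := hdec (n : ℤ) (s n) (s n) (hs1 n) le_rfl (hs2 n)
    rw [sub_self, neg_zero, Real.exp_zero, mul_one] at h1
    exact (hnn _ _ (hs1 n)).trans h1
  have hdec' : ∀ u ∈ Icc (s n) b, W (n : ℤ) u ≤ D * Real.exp (-(u - s n)) := fun u hu =>
    hdec (n : ℤ) (s n) u (hs1 n) hu.1 (hs2 n)
  -- antiderivatives
  have hF1 : ∀ u ∈ uIcc (s n) b, HasDerivAt (fun u => -D * Real.exp (-(u - s n)))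
      (D * Real.exp (-(u - s n))) u := by
    intro u _
    have h1 : HasDerivAt (fun x : ℝ => -(x - s n)) (-1) u := ((hasDerivAt_id' u).sub_const (s n)).neg
    exact (h1.exp.const_mul (-D)).congr_deriv (by ring)
  have hF2 : ∀ u ∈ uIcc (s n) b, HasDerivAt (fun u => -(D ^ 2 / 2) * Real.exp (-(2 * (u - s n))))
      (D ^ 2 * Real.exp (-(2 * (u - s n)))) u := by
    intro u _
    have h1 : HasDerivAt (fun x : ℝ => -(2 * (x - s n))) (-(2 * 1)) u :=
      (((hasDerivAt_id' u).sub_const (s n)).const_mul 2).neg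
    exact (h1.exp.const_mul (-(D ^ 2 / 2))).congr_deriv (by ring)
  have hcont1 : Continuous fun u => D * Real.exp (-(u - s n)) := by fun_prop
  have hcont2 : Continuous fun u => D ^ 2 * Real.exp (-(2 * (u - s n))) := by fun_prop
  have hI1 : ∫ u in s n..b, D * Real.exp (-(u - s n)) = -D * Real.exp (-(b - s n)) - -D * Real.exp 0 := by
    rw [integral_eq_sub_of_hasDerivAt hF1 (hcont1.intervalIntegrable _ _)]
    simp
  have hI2 : ∫ u in s n..b, D ^ 2 * Real.exp (-(2 * (u - s n)))
      = -(D ^ 2 / 2) * Real.exp (-(2 * (b - s n))) - -(D ^ 2 / 2) * Real.exp 0 := by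
    rw [integral_eq_sub_of_hasDerivAt hF2 (hcont2.intervalIntegrable _ _)]
    simp
  constructor
  · calc (∫ u in s n..b, W (n : ℤ) u) ≤ ∫ u in s n..b, D * Real.exp (-(u - s n)) :=
          integral_mono_on hb (intervalIntegrable_W hlaw _ hsA hbA) (hcont1.intervalIntegrable _ _) hdec'
      _ ≤ D := by
          rw [hI1, Real.exp_zero]
          have : 0 ≤ D * Real.exp (-(b - s n)) := by positivity
          linarith
  · calc (∫ u in s n..b, W (n : ℤ) u ^ 2) ≤ ∫ u in s n..b, D ^ 2 * Real.exp (-(2 * (u - s n))) := by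
          refine integral_mono_on hb (intervalIntegrable_W_sq hlaw _ hsA hbA)
            (hcont2.intervalIntegrable _ _) fun u hu => ?_
          have h0 : 0 ≤ W (n : ℤ) u := hnn _ u ((hs1 n).trans hu.1)
          have h1 := hdec' u hu
          calc W (n : ℤ) u ^ 2 ≤ (D * Real.exp (-(u - s n))) ^ 2 := pow_le_pow_left₀ h0 h1 2
            _ = D ^ 2 * Real.exp (-(2 * (u - s n))) := by
                rw [mul_pow, ← Real.exp_nat_mul]; ring_nf
      _ ≤ D ^ 2 / 2 := by
          rw [hI2, Real.exp_zero]
          have : 0 ≤ D ^ 2 / 2 * Real.exp (-(2 * (b - s n))) := by positivity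
          linarith

/-- **Pre-firing action recursion.**  With `a n = ∫_A^{s n} W n`: `a (n+1) ≤ (Λc)·a n + ΛD²/2`
(tree `preFiring_action_le`: `v + ∫v ≤ Λ∫u²` for the shell born empty; the feed's square-action splits at its own
first firing into `≤ c·a n` before and `≤ D²/2` after).
[cite: Tao2016AveragedNS, §1.2, §4 Lemma 4.1 (4.8), §6.4; elementary] -/
theorem preFiring_action_succ_le (hΛ : 0 < Λ) (hA : A₀ < A) (hc : 0 < c)
    (hlaw : ∀ (n : ℤ) (σ : ℝ), A₀ < σ → HasDerivAt (W n)
      (-(W n σ) + Λ * W (n - 1) σ ^ 2 - Λ⁻¹ * W n σ * W (n + 1) σ) σ)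
    (hnn : ∀ (n : ℤ) (σ : ℝ), A ≤ σ → 0 ≤ W n σ) (hstart : ∀ n : ℤ, 0 < n → W n A = 0)
    (hdec : ∀ (n : ℤ) (σ₁ σ₂ : ℝ), A ≤ σ₁ → σ₁ ≤ σ₂ → c ≤ W n σ₁ →
      W n σ₂ ≤ D * Real.exp (-(σ₂ - σ₁)))
    {s : ℕ → ℝ} (hs1 : ∀ n : ℕ, A ≤ s n) (hs2 : ∀ n : ℕ, c ≤ W n (s n))
    (hs3 : ∀ (n : ℕ) (σ : ℝ), A ≤ σ → c ≤ W (n : ℤ) σ → s n ≤ σ) (hmono : Monotone s) (n : ℕ) :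
    (∫ u in A..s (n + 1), W ((n + 1 : ℕ) : ℤ) u)
      ≤ Λ * c * (∫ u in A..s n, W (n : ℤ) u) + Λ * (D ^ 2 / 2) := by
  have hcast : ((n + 1 : ℕ) : ℤ) = (n : ℤ) + 1 := by push_cast; ring
  rw [hcast]
  set b : ℝ := s (n + 1) with hbdef
  have hAb : A ≤ b := hs1 (n + 1)
  -- the running actions
  set P : ℝ → ℝ := fun σ => ∫ u in A..σ, W ((n : ℤ) + 1) u with hP
  set Q : ℝ → ℝ := fun σ => ∫ u in A..σ, W (n : ℤ) u ^ 2 with hQ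
  have hcontv : ContinuousOn (W ((n : ℤ) + 1)) (Ioi A₀) := continuousOn_Ioi hlaw _
  have hcontu2 : ContinuousOn (fun u => W (n : ℤ) u ^ 2) (Ioi A₀) := (continuousOn_Ioi hlaw _).pow 2
  have hPd : ∀ σ, A₀ < σ → HasDerivAt P (W ((n : ℤ) + 1) σ) σ := fun σ hσ =>
    hasDerivAt_runningIntegral hcontv hA hσ
  have hQd : ∀ σ, A₀ < σ → HasDerivAt Q (W (n : ℤ) σ ^ 2) σ := fun σ hσ =>
    hasDerivAt_runningIntegral hcontu2 hA hσ
  have hv : ∀ σ ∈ Ico A b, HasDerivAt (W ((n : ℤ) + 1))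
      (-(W ((n : ℤ) + 1) σ) + Λ * W (n : ℤ) σ ^ 2 - Λ⁻¹ * W ((n : ℤ) + 1) σ * W ((n : ℤ) + 1 + 1) σ) σ := by
    intro σ hσ
    have := hlaw ((n : ℤ) + 1) σ (hA.trans_le hσ.1)
    rwa [add_sub_cancel_right] at this
  have hkey := preFiring_action_le hΛ hv (fun σ hσ => hPd σ (hA.trans_le hσ.1))
    (fun σ hσ => hQd σ (hA.trans_le hσ.1)) (continuousOn_Icc hlaw _ hA)
    (fun σ hσ => (hPd σ (hA.trans_le hσ.1)).continuousAt.continuousWithinAt)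
    (fun σ hσ => (hQd σ (hA.trans_le hσ.1)).continuousAt.continuousWithinAt)
    (fun σ hσ => hnn _ σ hσ.1) (fun σ hσ => hnn _ σ hσ.1)
    (hstart _ (by positivity)) (by simp [hP]) (by simp [hQ]) b (right_mem_Icc.2 hAb)
  -- `P b ≤ Λ Q b` since `v b ≥ 0`
  have hPb : P b ≤ Λ * Q b := by
    have := hnn ((n : ℤ) + 1) b hAb
    linarith
  -- split the feed's square-action at its own first firing `s n ≤ b`
  have hsn : A ≤ s n := hs1 n
  have hsnb : s n ≤ b := hmono (Nat.le_succ n)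
  have hsnA : A₀ < s n := hA.trans_le hsn
  have hbA : A₀ < b := hA.trans_le hAb
  have hsplit : Q b = (∫ u in A..s n, W (n : ℤ) u ^ 2) + ∫ u in s n..b, W (n : ℤ) u ^ 2 := by
    simp only [hQ]
    rw [integral_add_adjacent_intervals (intervalIntegrable_W_sq hlaw _ hA hsnA)
      (intervalIntegrable_W_sq hlaw _ hsnA hbA)]
  -- before: `W n < c`, so `W n ² ≤ c · W n`
  have hbefore : (∫ u in A..s n, W (n : ℤ) u ^ 2) ≤ c * ∫ u in A..s n, W (n : ℤ) u := by
    rw [← intervalIntegral.integral_const_mul]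
    refine integral_mono_on_of_le_Ioo hsn (intervalIntegrable_W_sq hlaw _ hA hsnA)
      ((intervalIntegrable_W hlaw _ hA hsnA).const_mul c) fun u hu => ?_
    have h0 : 0 ≤ W (n : ℤ) u := hnn _ u hu.1.le
    have h1 : W (n : ℤ) u < c := lt_level_before hs3 n hu.1.le hu.2
    nlinarith
  -- after: `≤ D²/2`
  have hafter : (∫ u in s n..b, W (n : ℤ) u ^ 2) ≤ D ^ 2 / 2 :=
    (postFiring_integrals_le hA hlaw hnn hdec hs1 hs2 n hsnb).2
  have hΛc0 : 0 ≤ Λ * c := by positivity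
  calc P b ≤ Λ * Q b := hPb
    _ = Λ * ((∫ u in A..s n, W (n : ℤ) u ^ 2) + ∫ u in s n..b, W (n : ℤ) u ^ 2) := by rw [hsplit]
    _ ≤ Λ * (c * (∫ u in A..s n, W (n : ℤ) u) + D ^ 2 / 2) := by gcongr
    _ = Λ * c * (∫ u in A..s n, W (n : ℤ) u) + Λ * (D ^ 2 / 2) := by ring

/-- **Uniform pre-firing action**: `∫_A^{s n} W n ≤ (ΛD²/2)/(1 − Λc)` for every shell (`Λc < 1`; `s 0 = A`).
[cite: Tao2016AveragedNS, §6.4; elementary (tree `action_recursion_bound`)] -/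
theorem preFiring_action_le_uniform (hΛ : 0 < Λ) (hA : A₀ < A) (hc : 0 < c) (hΛc : Λ * c < 1)
    (hlaw : ∀ (n : ℤ) (σ : ℝ), A₀ < σ → HasDerivAt (W n)
      (-(W n σ) + Λ * W (n - 1) σ ^ 2 - Λ⁻¹ * W n σ * W (n + 1) σ) σ)
    (hnn : ∀ (n : ℤ) (σ : ℝ), A ≤ σ → 0 ≤ W n σ)
    (hneg : ∀ n : ℤ, n < 0 → ∀ σ : ℝ, A ≤ σ → W n σ = 0) (hstart : ∀ n : ℤ, 0 < n → W n A = 0)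
    (hrate : ∀ σ : ℝ, A ≤ σ → ∃ n : ℤ, c ≤ W n σ)
    (hdec : ∀ (n : ℤ) (σ₁ σ₂ : ℝ), A ≤ σ₁ → σ₁ ≤ σ₂ → c ≤ W n σ₁ →
      W n σ₂ ≤ D * Real.exp (-(σ₂ - σ₁)))
    {s : ℕ → ℝ} (hs1 : ∀ n : ℕ, A ≤ s n) (hs2 : ∀ n : ℕ, c ≤ W n (s n))
    (hs3 : ∀ (n : ℕ) (σ : ℝ), A ≤ σ → c ≤ W (n : ℤ) σ → s n ≤ σ) (hmono : Monotone s) (n : ℕ) :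
    (∫ u in A..s n, W (n : ℤ) u) ≤ Λ * (D ^ 2 / 2) / (1 - Λ * c) := by
  have hΛc0 : 0 ≤ Λ * c := by positivity
  have hB0 : 0 ≤ Λ * (D ^ 2 / 2) := by positivity
  have hA0 : ∀ k : ℕ, 0 ≤ ∫ u in A..s k, W (k : ℤ) u := fun k =>
    integral_nonneg (hs1 k) fun u hu => hnn _ u hu.1
  have hrec : ∀ k : ℕ, (∫ u in A..s (k + 1), W ((k + 1 : ℕ) : ℤ) u)
      ≤ Λ * c * (∫ u in A..s k, W (k : ℤ) u) + Λ * (D ^ 2 / 2) := fun k =>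
    preFiring_action_succ_le hΛ hA hc hlaw hnn hstart hdec hs1 hs2 hs3 hmono k
  have h := action_recursion_bound (A := fun k : ℕ => ∫ u in A..s k, W (k : ℤ) u) hΛc0 hΛc hB0 hA0 hrec n
  have h0 : (∫ u in A..s 0, W 0 u) = 0 := by
    rw [firstFiring_zero hc hneg hstart hrate hs1 hs3, integral_same]
  simpa [h0] using h

/-- **Window mass (W).**  Every shell has `∫_a^b |W m| ≤ (ΛD²/2)/(1−Λc) + D` on every window `A < a ≤ b`.
[cite: Tao2016AveragedNS, §6.4; elementary] -/
theorem windowMass_le (hΛ : 0 < Λ) (hA : A₀ < A) (hc : 0 < c) (hΛc : Λ * c < 1)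
    (hlaw : ∀ (n : ℤ) (σ : ℝ), A₀ < σ → HasDerivAt (W n)
      (-(W n σ) + Λ * W (n - 1) σ ^ 2 - Λ⁻¹ * W n σ * W (n + 1) σ) σ)
    (hnn : ∀ (n : ℤ) (σ : ℝ), A ≤ σ → 0 ≤ W n σ)
    (hneg : ∀ n : ℤ, n < 0 → ∀ σ : ℝ, A ≤ σ → W n σ = 0) (hstart : ∀ n : ℤ, 0 < n → W n A = 0)
    (hrate : ∀ σ : ℝ, A ≤ σ → ∃ n : ℤ, c ≤ W n σ)
    (hdec : ∀ (n : ℤ) (σ₁ σ₂ : ℝ), A ≤ σ₁ → σ₁ ≤ σ₂ → c ≤ W n σ₁ →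
      W n σ₂ ≤ D * Real.exp (-(σ₂ - σ₁)))
    {s : ℕ → ℝ} (hs1 : ∀ n : ℕ, A ≤ s n) (hs2 : ∀ n : ℕ, c ≤ W n (s n))
    (hs3 : ∀ (n : ℕ) (σ : ℝ), A ≤ σ → c ≤ W (n : ℤ) σ → s n ≤ σ) (hmono : Monotone s)
    (m : ℤ) {a b : ℝ} (ha : A < a) (hab : a ≤ b) :
    (∫ u in a..b, |W m u|) ≤ Λ * (D ^ 2 / 2) / (1 - Λ * c) + D := by
  have hcD : c ≤ D := level_le_D hc hneg hstart hrate hdec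
  have hPstar : 0 ≤ Λ * (D ^ 2 / 2) / (1 - Λ * c) := by
    have : 0 < 1 - Λ * c := by linarith
    positivity
  have hD0 : 0 ≤ D := hc.le.trans hcD
  -- `|W m| = W m` on the window
  have habs : (∫ u in a..b, |W m u|) = ∫ u in a..b, W m u := by
    refine integral_congr fun u hu => ?_
    rw [uIcc_of_le hab] at hu
    exact abs_of_nonneg (hnn m u (ha.le.trans hu.1))
  rw [habs]
  rcases lt_or_ge m 0 with hm | hm
  · -- negative shells vanish
    have h0 : (∫ u in a..b, W m u) = ∫ u in a..b, (0 : ℝ) := by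
      refine integral_congr fun u hu => ?_
      rw [uIcc_of_le hab] at hu
      exact hneg m hm u (ha.le.trans hu.1)
    rw [h0, intervalIntegral.integral_zero]
    positivity
  · obtain ⟨k, rfl⟩ : ∃ k : ℕ, (k : ℤ) = m := ⟨m.toNat, Int.toNat_of_nonneg hm⟩
    set b' : ℝ := max b (s k) with hb'
    have hAa : A₀ < a := hA.trans ha
    have hAb' : A₀ < b' := hAa.trans_le (hab.trans (le_max_left _ _))
    have hsk : A₀ < s k := hA.trans_le (hs1 k)
    -- enlarge the window to `[A, b']`
    have h1 : (∫ u in a..b, W (k : ℤ) u) ≤ ∫ u in A..b', W (k : ℤ) u := by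
      refine integral_mono_interval ha.le hab (le_max_left _ _) ?_ (intervalIntegrable_W hlaw _ hA hAb')
      refine (ae_restrict_iff' measurableSet_Ioc).2 (Eventually.of_forall fun u hu => ?_)
      exact hnn _ u hu.1.le
    -- split at the first firing
    have h2 : (∫ u in A..b', W (k : ℤ) u)
        = (∫ u in A..s k, W (k : ℤ) u) + ∫ u in s k..b', W (k : ℤ) u := by
      rw [integral_add_adjacent_intervals (intervalIntegrable_W hlaw _ hA hsk)
        (intervalIntegrable_W hlaw _ hsk hAb')]
    have h3 := preFiring_action_le_uniform hΛ hA hc hΛc hlaw hnn hneg hstart hrate hdec hs1 hs2 hs3 hmono k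
    have h4 := (postFiring_integrals_le hA hlaw hnn hdec hs1 hs2 k (le_max_right b (s k))).1
    linarith

end WakeRatchetDyadicPostFiring

end Summit.NavierStokesRegularity.NavierStokesRegularity.Theorems

end
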